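import Literature.AnabelianGeometry.EtaleTheta.Discharge.Sec5Prop53SurjectionOrders
import Literature.AnabelianGeometry.EtaleTheta.Discharge.Sec5Prop53Toy
import HarnessLib

/-!
# [EtTh] §5, Prop. 5.3: the INTERSECTION THEORY OF THE CHAIN on abc-iut-f-009's toy `Φ(A_⊚) = ⊕_{ℤ ⊔ ℤ} ℚ_{≥0}` —
# coefficient factorization, degree-zero principal classes, rigidity of cuspidal classes, transport

Mochizuki, *The étale theta function and its Frobenioid-theoretic manifestations*, Publ. RIMS **45** (2009), §5, Prop. 5.3,
proof pp. 326–327 (PDF pp. 100–101): "the well-known intersection theory of divisors supported on the chain of copies of the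
projective line" [cite: MochizukiEtTh2009, Prop 5.3 proof p.326 (PDF p.100)]; §1 p. 240 (PDF p. 14): "the isomorphism class of
a line bundle on `𝔜_N` is completely determined by the degree of the restriction of the line bundle to each of these copies of
the projective line … these degrees determine an isomorphism `Pic(𝔜_N) ⥲ ℤ^ℤ`" [cite: MochizukiEtTh2009, §1 p.240 (PDF p.14)];
Prop. 3.2 (i) p. 296 (PDF p. 70) (product-valued factorization).  Cell abc-iut, block F, seat abc-iut-f-127 (gen 2).
TOY-DATA companion (plumbing `def`s over abc-iut-f-009's `Sec5Prop53Toy.lean` — no `Prop` fact, no instance, nothing landed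
is edited) preparing the NON-VACUITY CERTIFICATES `Sec5Prop53CriteriaToyNVSurjection.lean` / `…Adjacency.lean` for the
p.326/327 CRITERIA binders of the order-coordinate instance forms of Prop. 5.3 (iv) (`preservesCspToNcsp_of_orders`, this seat,
p439550) and (v) (`preservesNcspLabels_of_orders`, abc-iut-f-128, p438690).

CONTENT (all on the toy `𝔉 := toyThetaDiv`, `𝔓 := toyPrimeData`: components `C_k = P (inl k)`, cusps `cusp_k = P (inr k)`,
`cusp_k ↦ C_k`, labels `C_k ↦ k`):
* `toyFactor : Φ(A_⊚) → ∏_𝔭 ℚ` — the coefficient embedding (the binder `factor`); `cf i x` — the `i`-th coefficient on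
  `Φ(A_⊚)^gp`; `eq_of_cf_eq` — coefficients separate `Φ(A_⊚)^gp`;
* `toyDeg k` — the DEGREE on the component `C_k`: `x_{inl(k−1)} − 2·x_{inl k} + x_{inl(k+1)} + x_{inr k}` (incidence numbers
  `C_k · C_{k±1} = 1`, `C_k² = −2`, `cusp_k · C_k = 1`); `toyPrincipal := ⋂_k ker (toyDeg k)` — the degree-zero classes (the
  binder `P`, "principal iff all degrees vanish");
* `cusp k q = q·cusp_k`, `comp k q = q·C_k` and their coefficients; `cf_of_mem_carrier` — a primary element of `P i`
  has one positive coefficient, at `i`;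
* `eq_of_isCuspidalGp_of_linEquiv` — RIGIDITY: two cuspidal elements of `Φ(A_⊚)^gp` in the same class are equal;
* `ordMap_toy` — the binder `hψo` holds for EVERY re-indexing `e = reindex σ`; `gpMap_psiToy_shift_mem_toyPrincipal_iff` —
  the binder `hP` holds for the chain translations `shift t`; `cuspPreserved_shift` — (i) on primes for them;

HONEST FRAMING: a toy datum; statements about OUR binders, nothing about the tempered Frobenioid of [EtTh] §5 or [IUTchIII]
Cor. 3.12; no side taken; typed ≠ proved.
-/

namespace Literature.AnabelianGeometry.EtaleTheta

namespace FrobenioidThetaDivisors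

namespace Prop53Toy

open CategoryTheory
open Literature.AlgebraicGeometry.Frobenioids
open ConstantMultiple ConstantMultiple.Cor512Toy

/-! ### The coefficient factorization `Φ(A_⊚) = ⊕_{ℤ ⊔ ℤ} ℚ_{≥0} ↪ ∏_𝔭 ℚ` and the degree-zero classes -/

/-- `Φ(A_⊚)` of the toy datum, in the §5 spelling (`= ⊕_{ℤ ⊔ ℤ} ℚ_{≥0}`, `phiAcirc_eq`).
[cite: MochizukiEtTh2009, Prop 5.3 p.325 (PDF p.99)] -/
abbrev PhiToy : Type := toyThetaDiv.PhiAcirc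

/-- `Φ(A_⊚)^gp` of the toy datum. [cite: MochizukiEtTh2009, Prop 5.3 (vi) p.326 (PDF p.100)] -/
abbrev GpToy : Type := Algebra.GrothendieckGroup toyThetaDiv.PhiAcirc

/-- The prime `P i` read in `Prime(Φ(A_⊚))` of the §5 datum. [cite: MochizukiFrdI2008, §0 p.12] -/
noncomputable abbrev Pt (i : Idx) : Primes PhiToy := P i

/-- `idx (Pt i) = i`. [cite: MochizukiFrdI2008, §0 p.12] -/
theorem idx_Pt (i : Idx) : idx (Pt i) = i := idx_P i

/-- `Pt (idx 𝔭) = 𝔭`. [cite: MochizukiFrdI2008, §0 p.12] -/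
theorem Pt_idx (𝔭 : Primes PhiToy) : Pt (idx 𝔭) = 𝔭 := P_idx 𝔭

/-- The `i`-th coefficient of `⊕_{ℤ ⊔ ℤ} ℚ_{≥0}`, read in (multiplicatively written) `ℚ`.
[cite: MochizukiEtTh2009, Prop 3.2 (i) p.296 (PDF p.70)] -/
noncomputable def coeffQ (i : Idx) : Φt →* Multiplicative ℚ :=
  (AddMonoidHom.toMultiplicative (NNRat.coeHom : ℚ≥0 →+* ℚ).toAddMonoidHom).comp
    ((Pi.evalMonoidHom Fac i).comp (directSum Fac).subtype)

/-- **The toy product-valued factorization** `Φ(A_⊚) = ⊕_{ℤ ⊔ ℤ} ℚ_{≥0} → ∏_𝔭 ℚ`, `a ↦ (a_{idx 𝔭})_𝔭` (the binder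
`factor` of the order-coordinate instance forms; [EtTh] Prop. 3.2 (i): "a direct product of copies of `ℚ_{≥0}`").
[cite: MochizukiEtTh2009, Prop 3.2 (i) p.296 (PDF p.70)] -/
noncomputable def toyFactor : PhiToy →* (Primes PhiToy → Multiplicative ℚ) :=
  MonoidHom.pi fun 𝔭 => coeffQ (idx 𝔭)

/-- The `i`-th coefficient of an element of `Φ(A_⊚)^gp`, in `ℚ` (the order at the prime `P i`).
[cite: MochizukiEtTh2009, Prop 5.3 proof p.326 (PDF p.100)] -/
noncomputable def cf (i : Idx) (x : GpToy) : ℚ :=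
  Multiplicative.toAdd (ordGpOf' toyFactor (Pt i) x)

/-- **The degree on the irreducible component `k` of the chain** ([EtTh] §1 p.240 (PDF p.14): the special fibre is
"an infinite chain of copies of the projective line"; `C_k · C_k = −2`, `C_k · C_{k±1} = 1`, and the cusp `k` meets
`C_k` once): `deg_k(x) = x_{inl(k−1)} − 2·x_{inl k} + x_{inl(k+1)} + x_{inr k}`, as a homomorphism
`Φ(A_⊚)^gp → ℚ`. [cite: MochizukiEtTh2009, §1 p.240 (PDF p.14)] -/
noncomputable def toyDeg (k : ℤ) : GpToy →* Multiplicative ℚ where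
  toFun x := Multiplicative.ofAdd
    (cf (Sum.inl (k - 1)) x - 2 * cf (Sum.inl k) x + cf (Sum.inl (k + 1)) x + cf (Sum.inr k) x)
  map_one' := by simp [cf]
  map_mul' x y := by
    rw [← ofAdd_add]
    congr 1
    simp only [cf, map_mul, toAdd_mul]
    ring

/-- **The toy principal divisors** `P ⊆ Φ(A_⊚)^gp`: the classes of degree `0` on every irreducible component
([EtTh] §1 p.240 (PDF p.14): "these degrees determine an isomorphism `Pic(𝔜_N) ⥲ ℤ^ℤ`" — a divisor is principal
iff all its degrees vanish; the binder `P` / F1 of the order-coordinate instance forms).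
[cite: MochizukiEtTh2009, §1 p.240 (PDF p.14)] -/
noncomputable def toyPrincipal : Subgroup GpToy := ⨅ k : ℤ, (toyDeg k).ker

/-! ### Coefficient calculus -/

/-- `ordOf' toyFactor 𝔭 a` is the `idx 𝔭`-coefficient of `a`. [cite: MochizukiEtTh2009, Prop 3.2 (i) p.296 (PDF p.70)] -/
theorem toAdd_ordOf'_toyFactor (𝔭 : Primes PhiToy) (a : Φt) :
    Multiplicative.toAdd (ordOf' toyFactor 𝔭 a) = ((Multiplicative.toAdd ((a : ∀ j, Fac j) (idx 𝔭)) : ℚ≥0) : ℚ) :=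
  rfl

/-- `ordGpOf' factor 𝔭` extends `ordOf' factor 𝔭` along `Φ → Φ^gp` (any factorization).
[cite: MochizukiEtTh2009, Prop 5.3 proof p.326 (PDF p.100)] -/
theorem ordGpOf'_of {Φ : Type*} [CommMonoid Φ] (factor : Φ →* (Primes Φ → Multiplicative ℚ)) (𝔭 : Primes Φ) (a : Φ) :
    ordGpOf' factor 𝔭 (Algebra.GrothendieckGroup.of a) = ordOf' factor 𝔭 a := by
  have h := Algebra.GrothendieckGroup.lift.symm_apply_apply (ordOf' factor 𝔭)
  rw [Algebra.GrothendieckGroup.lift_symm_apply] at h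
  exact DFunLike.congr_fun h a

/-- `cf` is additive. [cite: MochizukiEtTh2009, Prop 5.3 proof p.326 (PDF p.100)] -/
@[simp] theorem cf_mul (i : Idx) (x y : GpToy) : cf i (x * y) = cf i x + cf i y := by
  simp [cf, map_mul]

/-- `cf` of an inverse. [cite: MochizukiEtTh2009, Prop 5.3 proof p.326 (PDF p.100)] -/
@[simp] theorem cf_inv (i : Idx) (x : GpToy) : cf i x⁻¹ = -cf i x := by
  simp [cf, map_inv]

/-- `cf` of `1`. [cite: MochizukiEtTh2009, Prop 5.3 proof p.326 (PDF p.100)] -/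
@[simp] theorem cf_one (i : Idx) : cf i (1 : GpToy) = 0 := by
  simp [cf]

/-- `cf i [a] = a_i`. [cite: MochizukiEtTh2009, Prop 5.3 proof p.326 (PDF p.100)] -/
theorem cf_of (i : Idx) (a : Φt) :
    cf i (Algebra.GrothendieckGroup.of a) = ((Multiplicative.toAdd ((a : ∀ j, Fac j) i) : ℚ≥0) : ℚ) := by
  rw [cf, ordGpOf'_of, toAdd_ordOf'_toyFactor, idx_Pt]

/-- `cf j [x_i^a] = a` if `j = i`, `0` otherwise. [cite: MochizukiEtTh2009, Prop 5.3 proof p.326 (PDF p.100)] -/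
theorem cf_of_single (i j : Idx) (a : Multiplicative NNRat) :
    cf j (Algebra.GrothendieckGroup.of (DirectSum.single (M := Fac) i a)) =
      if j = i then ((Multiplicative.toAdd a : ℚ≥0) : ℚ) else 0 := by
  rw [cf_of]
  split_ifs with h
  · subst h; rw [DirectSum.single_apply_same]
  · rw [DirectSum.single_apply_of_ne h]; rfl

/-- The coefficient at the prime `𝔭` is `cf (idx 𝔭)`. [cite: MochizukiEtTh2009, Prop 5.3 proof p.326 (PDF p.100)] -/
theorem toAdd_ordGpOf'_eq_cf (𝔭 : Primes PhiToy) (x : GpToy) :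
    Multiplicative.toAdd (ordGpOf' toyFactor 𝔭 x) = cf (idx 𝔭) x := by
  rw [cf, Pt_idx]

/-- Every element of a Grothendieck group is a fraction. [folklore] -/
private theorem exists_eq_of_div_of {M : Type*} [CommMonoid M] (z : Algebra.GrothendieckGroup M) :
    ∃ a b : M, z = Algebra.GrothendieckGroup.of a / Algebra.GrothendieckGroup.of b := by
  induction z using Localization.induction_on with
  | H y =>
    refine ⟨y.1, y.2, eq_div_iff_mul_eq'.mpr ?_⟩
    rw [Localization.mk_eq_monoidOf_mk'_apply]
    exact Submonoid.LocalizationMap.mk'_spec _ _ _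

/-- **An element of `Φ(A_⊚)^gp` is determined by its coefficients** (`hsep` for the toy factorization).
[cite: MochizukiEtTh2009, Prop 3.2 (i) p.296 (PDF p.70)] -/
theorem eq_of_cf_eq {x y : GpToy} (h : ∀ i, cf i x = cf i y) : x = y := by
  obtain ⟨a, b, rfl⟩ := exists_eq_of_div_of x
  obtain ⟨c, d, rfl⟩ := exists_eq_of_div_of y
  rw [div_eq_div_iff_mul_eq_mul, ← map_mul, ← map_mul]
  refine congrArg Algebra.GrothendieckGroup.of (Subtype.ext (funext fun i => ?_))
  have hi := h i
  simp only [div_eq_mul_inv, cf_mul, cf_inv, cf_of] at hi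
  have key : ((Multiplicative.toAdd (Subtype.val a i) : ℚ≥0) : ℚ) + Multiplicative.toAdd (Subtype.val d i) =
      ((Multiplicative.toAdd (Subtype.val c i) : ℚ≥0) : ℚ) + Multiplicative.toAdd (Subtype.val b i) := by
    linarith
  apply Multiplicative.toAdd.injective
  change Multiplicative.toAdd (Subtype.val a i * Subtype.val d i) =
    Multiplicative.toAdd (Subtype.val c i * Subtype.val b i)
  rw [toAdd_mul, toAdd_mul]
  exact_mod_cast key

/-- `x = 1` iff all coefficients vanish. [cite: MochizukiEtTh2009, Prop 3.2 (i) p.296 (PDF p.70)] -/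
theorem eq_one_of_cf_eq_zero {x : GpToy} (h : ∀ i, cf i x = 0) : x = 1 :=
  eq_of_cf_eq fun i => by rw [h i, cf_one]

/-! ### Supports, cuspidality and principality in coefficients -/

/-- `𝔭 ∈ supp x` iff the `idx 𝔭`-coefficient of `x` is non-zero. [cite: MochizukiEtTh2009, Prop 5.3 proof p.326 (PDF p.100)] -/
theorem mem_suppOf'_iff (𝔭 : Primes PhiToy) (x : GpToy) :
    𝔭 ∈ suppOf' toyFactor x ↔ cf (idx 𝔭) x ≠ 0 := by
  change ordGpOf' toyFactor 𝔭 x ≠ 1 ↔ _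
  rw [← toAdd_ordGpOf'_eq_cf]
  exact ⟨fun h h' => h (by rw [← ofAdd_toAdd (ordGpOf' toyFactor 𝔭 x), h', ofAdd_zero]),
    fun h h' => h (by rw [h', toAdd_one])⟩

/-- `P i ∈ supp x` iff `cf i x ≠ 0`. [cite: MochizukiEtTh2009, Prop 5.3 proof p.326 (PDF p.100)] -/
theorem Pt_mem_suppOf'_iff (i : Idx) (x : GpToy) :
    Pt i ∈ suppOf' toyFactor x ↔ cf i x ≠ 0 := by
  rw [mem_suppOf'_iff, idx_Pt]

/-- An element of `Φ(A_⊚)^gp` is cuspidal iff its coefficients at the irreducible components vanish.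
[cite: MochizukiEtTh2009, Prop 5.3 proof p.326 (PDF p.100)] -/
theorem isCuspidalGpOf'_iff (x : GpToy) :
    IsCuspidalGpOf' toyPrimeData toyFactor x ↔ ∀ n : ℤ, cf (Sum.inl n) x = 0 := by
  change (∀ 𝔭 : Primes PhiToy, 𝔭 ∈ suppOf' toyFactor x → IsCusp 𝔭) ↔ _
  constructor
  · intro h n
    by_contra hn
    exact not_isCusp_P_inl n (h (Pt (Sum.inl n)) ((Pt_mem_suppOf'_iff _ _).mpr hn))
  · intro h 𝔭 h𝔭
    rw [mem_suppOf'_iff] at h𝔭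
    rcases hi : idx 𝔭 with n | n
    · rw [hi] at h𝔭; exact (h𝔭 (h n)).elim
    · exact ⟨n, hi⟩

/-- `deg_k` in coefficients. [cite: MochizukiEtTh2009, §1 p.240 (PDF p.14)] -/
theorem toAdd_toyDeg (k : ℤ) (x : GpToy) :
    Multiplicative.toAdd (toyDeg k x) =
      cf (Sum.inl (k - 1)) x - 2 * cf (Sum.inl k) x + cf (Sum.inl (k + 1)) x + cf (Sum.inr k) x := rfl

/-- Membership in the toy principal divisors: all degrees vanish. [cite: MochizukiEtTh2009, §1 p.240 (PDF p.14)] -/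
theorem mem_toyPrincipal_iff (x : GpToy) :
    x ∈ toyPrincipal ↔
      ∀ k : ℤ, cf (Sum.inl (k - 1)) x - 2 * cf (Sum.inl k) x + cf (Sum.inl (k + 1)) x + cf (Sum.inr k) x = 0 := by
  rw [toyPrincipal, Subgroup.mem_iInf]
  refine forall_congr' fun k => ?_
  rw [MonoidHom.mem_ker, ← toAdd_toyDeg]
  exact ⟨fun h => by rw [h, toAdd_one], fun h => by rw [← ofAdd_toAdd (toyDeg k x), h, ofAdd_zero]⟩

/-- Linear equivalence for the toy `P`, in coefficients. [cite: MochizukiEtTh2009, Prop 5.3 proof p.326 (PDF p.100)] -/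
theorem linEquivOf_toyPrincipal_iff (x y : GpToy) :
    LinEquivOf toyPrincipal x y ↔
      ∀ k : ℤ, cf (Sum.inl (k - 1)) (x * y⁻¹) - 2 * cf (Sum.inl k) (x * y⁻¹) + cf (Sum.inl (k + 1)) (x * y⁻¹) +
        cf (Sum.inr k) (x * y⁻¹) = 0 :=
  mem_toyPrincipal_iff (x * y⁻¹)

/-- **Rigidity of cuspidal classes**: two CUSPIDAL elements of `Φ(A_⊚)^gp` that are linearly equivalent (for the
degree-zero `P`) are EQUAL — a cuspidal principal divisor has all degrees `= its cusp coefficients = 0`.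
[cite: MochizukiEtTh2009, §1 p.240 (PDF p.14); Prop 5.3 proof p.326 (PDF p.100)] -/
theorem eq_of_isCuspidalGp_of_linEquiv {x y : GpToy}
    (hx : IsCuspidalGpOf' toyPrimeData toyFactor x) (hy : IsCuspidalGpOf' toyPrimeData toyFactor y)
    (h : LinEquivOf toyPrincipal x y) : x = y := by
  rw [isCuspidalGpOf'_iff] at hx hy
  rw [linEquivOf_toyPrincipal_iff] at h
  rw [← mul_inv_eq_one]
  refine eq_one_of_cf_eq_zero fun i => ?_
  rcases i with n | n
  · rw [cf_mul, cf_inv, hx, hy, neg_zero, add_zero]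
  · have := h n
    simp only [cf_mul, cf_inv, hx, hy] at this
    simpa using this

/-! ### Transport under re-indexing: `hψo` (every `σ`) and `hP` (chain translations) -/

/-- Components of a re-indexed element (private twin of abc-iut-f-128's `Prop53Chain.reindex_apply`).
[cite: MochizukiEtTh2009, Prop 5.3 p.325 (PDF p.99)] -/
private theorem coe_reindex_apply (σ : Idx ≃ Idx) (a : Φt) (j : Idx) :
    ((reindex σ a : Φt) : ∀ j, Fac j) j = (a : ∀ j, Fac j) (σ.symm j) := rfl

/-- `Ψ^Φ_{A_⊚}` of the toy datum for `e = reindex σ` (`Ψ = 𝟭`, `ι = 𝟙`), as an automorphism of `Φ(A_⊚)`.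
[cite: MochizukiEtTh2009, Prop 5.3 p.325 (PDF p.99)] -/
noncomputable abbrev psiToy (σ : Idx ≃ Idx) : PhiToy ≃* PhiToy :=
  psiPhi toyThetaDiv (CategoryTheory.Equivalence.refl : TC ≌ TC) (Iso.refl Q) (reindex σ)

/-- `Ψ^Φ a = reindex σ a`. [cite: MochizukiEtTh2009, Prop 5.3 p.325 (PDF p.99)] -/
theorem psiToy_apply (σ : Idx ≃ Idx) (a : PhiToy) : psiToy σ a = reindex σ a := rfl

/-- `idx (Ψ^Φ 𝔭) = σ (idx 𝔭)`. [cite: MochizukiFrdI2008, §0 p.12] -/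
theorem idx_congr_psiToy (σ : Idx ≃ Idx) (𝔭 : Primes PhiToy) : idx (Primes.congr (psiToy σ) 𝔭) = σ (idx 𝔭) :=
  idx_congr_reindex σ 𝔭

/-- **The binder `hψo` holds at the toy for EVERY re-indexing `e = reindex σ`**: `ord_{Ψ^Φ𝔭}(Ψ^Φ a) = ord_𝔭(a)` —
a re-indexing carries the coefficients along. [cite: MochizukiEtTh2009, Prop 5.3 p.325 (PDF p.99)] -/
theorem ordMap_toy (σ : Idx ≃ Idx) (𝔭 : Primes PhiToy) (a : PhiToy) :
    ordOf' toyFactor (Primes.congr (psiToy σ) 𝔭) (psiToy σ a) = ordOf' toyFactor 𝔭 a := by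
  apply Multiplicative.toAdd.injective
  rw [toAdd_ordOf'_toyFactor, toAdd_ordOf'_toyFactor, idx_congr_psiToy, psiToy_apply, coe_reindex_apply,
    Equiv.symm_apply_apply]

/-- Coefficients of a transported class: `cf_j ((Ψ^Φ)^gp x) = cf_{σ⁻¹ j}(x)` for `e = reindex σ`.
[cite: MochizukiEtTh2009, Prop 5.3 proof p.326 (PDF p.100)] -/
theorem cf_gpMap_psiToy (σ : Idx ≃ Idx) (j : Idx) (x : GpToy) :
    cf j (ThetaFrobenioid.gpMap (psiToy σ).toMonoidHom x) = cf (σ.symm j) x := by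
  obtain ⟨a, b, rfl⟩ := exists_eq_of_div_of x
  simp only [div_eq_mul_inv, map_mul, map_inv, cf_mul, cf_inv, ThetaFrobenioid.gpMap_of, MulEquiv.coe_toMonoidHom,
    psiToy_apply, cf_of, coe_reindex_apply]

/-- The chain translation by `t`, on cusps and components alike. [cite: MochizukiEtTh2009, §1 p.239 (PDF p.13)] -/
def shift (t : ℤ) : Idx ≃ Idx := Equiv.sumCongr (Equiv.addRight t) (Equiv.addRight t)

/-- `(shift t)⁻¹ (inl k) = inl (k − t)`. [cite: MochizukiEtTh2009, §1 p.239 (PDF p.13)] -/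
@[simp] theorem shift_symm_inl (t k : ℤ) : (shift t).symm (Sum.inl k) = Sum.inl (k + -t) := by
  simp [shift, Equiv.addRight_symm]

/-- `(shift t)⁻¹ (inr k) = inr (k − t)`. [cite: MochizukiEtTh2009, §1 p.239 (PDF p.13)] -/
@[simp] theorem shift_symm_inr (t k : ℤ) : (shift t).symm (Sum.inr k) = Sum.inr (k + -t) := by
  simp [shift, Equiv.addRight_symm]

/-- **The binder `hP` holds at the toy for the chain translations** `e = reindex (shift t)`: `(Ψ^Φ)^gp` preserves
the degree-zero classes (`deg_k ∘ (Ψ^Φ)^gp = deg_{k−t}`).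
[cite: MochizukiEtTh2009, §1 p.240 (PDF p.14); Prop 5.3 proof p.326 (PDF p.100)] -/
theorem gpMap_psiToy_shift_mem_toyPrincipal_iff (t : ℤ) (x : GpToy) :
    ThetaFrobenioid.gpMap (psiToy (shift t)).toMonoidHom x ∈ toyPrincipal ↔ x ∈ toyPrincipal := by
  rw [mem_toyPrincipal_iff, mem_toyPrincipal_iff]
  simp only [cf_gpMap_psiToy, shift_symm_inl, shift_symm_inr]
  constructor
  · intro h k
    have := h (k + t)
    rwa [show k + t - 1 + -t = k - 1 by ring, show k + t + -t = k by ring, show k + t + 1 + -t = k + 1 by ring] at this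
  · intro h k
    have := h (k + -t)
    rwa [show k + -t - 1 = k - 1 + -t by ring, show k + -t + 1 = k + 1 + -t by ring] at this

/-! ### Prop. 5.3 (i) on primes for the chain translations of the toy -/

/-- A chain translation preserves cuspidality of primes (the hypothesis `hc` = Prop. 5.3 (i) on primes).
[cite: MochizukiEtTh2009, Prop 5.3 (i) p.325 (PDF p.99)] -/
theorem cuspPreserved_shift (t : ℤ) :
    CuspPreserved toyPrimeData (CategoryTheory.Equivalence.refl : TC ≌ TC) (Iso.refl Q) (reindex (shift t)) := by
  intro 𝔭
  change IsCusp (Primes.congr (reindex (shift t)) 𝔭) ↔ IsCusp 𝔭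
  unfold IsCusp
  rw [idx_congr_reindex]
  rcases idx 𝔭 with n | n
  · simp [shift]
  · simp [shift]


/-! ### Cusps, components and primary elements in coefficients -/

/-- `cusp k q := q · [the cusp `k`]` (`= x_{inr k}^q`), an element of `Φ(A_⊚)` of the toy datum.
[cite: MochizukiEtTh2009, Prop 5.3 proof p.326 (PDF p.100)] -/
noncomputable def cusp (k : ℤ) (q : NNRat) : PhiToy := DirectSum.single (M := Fac) (Sum.inr k) (Multiplicative.ofAdd q)

/-- `comp k q := q · C_k` (`= x_{inl k}^q`), an element of `Φ(A_⊚)` of the toy datum supported on the component `k`.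
[cite: MochizukiEtTh2009, Prop 5.3 proof p.326 (PDF p.100)] -/
noncomputable def comp (k : ℤ) (q : NNRat) : PhiToy := DirectSum.single (M := Fac) (Sum.inl k) (Multiplicative.ofAdd q)

/-- `ofAdd q ≠ 1` for `q ≠ 0`. [folklore] -/
private theorem ofAdd_ne_one {q : NNRat} (hq : q ≠ 0) : Multiplicative.ofAdd q ≠ 1 := by
  rw [Ne, ← ofAdd_zero, Multiplicative.ofAdd.injective.eq_iff]; exact hq

/-- Coefficients of `[cusp k q]`. [cite: MochizukiEtTh2009, Prop 5.3 proof p.326 (PDF p.100)] -/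
@[simp] theorem cf_cusp (k : ℤ) (q : NNRat) (i : Idx) :
    cf i (Algebra.GrothendieckGroup.of (cusp k q)) = if i = Sum.inr k then (q : ℚ) else 0 := by
  rw [cusp, cf_of_single]; rfl

/-- Coefficients of `[comp k q]`. [cite: MochizukiEtTh2009, Prop 5.3 proof p.326 (PDF p.100)] -/
@[simp] theorem cf_comp (k : ℤ) (q : NNRat) (i : Idx) :
    cf i (Algebra.GrothendieckGroup.of (comp k q)) = if i = Sum.inl k then (q : ℚ) else 0 := by
  rw [comp, cf_of_single]; rfl

/-- `cusp k q` is a primary element of the cusp `k` (`q ≠ 0`). [cite: MochizukiFrdI2008, §0 p.12] -/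
theorem cusp_mem_carrier (k : ℤ) {q : NNRat} (hq : q ≠ 0) : cusp k q ∈ (Pt (Sum.inr k)).carrier :=
  (DirectSum.mem_carrier_primeOf_iff fac_monoprime _ _).mpr (DirectSum.dsupp_single (ofAdd_ne_one hq))

/-- `comp k q` is a primary element of the component `k` (`q ≠ 0`). [cite: MochizukiFrdI2008, §0 p.12] -/
theorem comp_mem_carrier (k : ℤ) {q : NNRat} (hq : q ≠ 0) : comp k q ∈ (Pt (Sum.inl k)).carrier :=
  (DirectSum.mem_carrier_primeOf_iff fac_monoprime _ _).mpr (DirectSum.dsupp_single (ofAdd_ne_one hq))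

/-- Coefficients of a primary element of `P i`: `q ≠ 0` at `i`, `0` elsewhere. [cite: MochizukiFrdI2008, §0 p.12] -/
theorem cf_of_mem_carrier {i : Idx} {a : Φt} (ha : a ∈ (Pt i).carrier) (m : Idx) :
    cf m (Algebra.GrothendieckGroup.of a) = if m = i then cf i (Algebra.GrothendieckGroup.of a) else 0 := by
  split_ifs with h
  · rw [h]
  · rw [cf_of]
    have hs := (DirectSum.mem_carrier_primeOf_iff fac_monoprime i a).mp ha
    have hm : m ∉ dsupp (a : ∀ j, Fac j) := by rw [hs]; exact h
    rw [mem_dsupp_iff, not_not] at hm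
    rw [hm]; rfl

/-- The coefficient of a primary element of `P i` at `i` is positive. [cite: MochizukiFrdI2008, §0 p.12] -/
theorem cf_pos_of_mem_carrier {i : Idx} {a : Φt} (ha : a ∈ (Pt i).carrier) :
    0 < cf i (Algebra.GrothendieckGroup.of a) := by
  rw [cf_of]
  have hi := DirectSum.mem_dsupp_of_mem_carrier fac_monoprime ha
  rw [mem_dsupp_iff] at hi
  have h0 : Multiplicative.toAdd ((a : ∀ j, Fac j) i) ≠ 0 := fun h => hi (by
    rw [← ofAdd_toAdd ((a : ∀ j, Fac j) i), h, ofAdd_zero])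
  exact_mod_cast pos_iff_ne_zero.mpr h0

end Prop53Toy

end FrobenioidThetaDivisors

end Literature.AnabelianGeometry.EtaleTheta
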